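import Summits.Ventures.HodgeRepro2.T5SU11FibrationCocycle
import Summits.Ventures.HodgeRepro2.T5SU11BorelHaarNA

/-!
# The `K`-projection `g ↦ phase g₀₀` of the polar decomposition `g = s(g·0) · k(g)`

By the polar decomposition of `T5SU11FibrationCocycle` (`g = s(g·0) · rot (phase g₀₀)`), every
`g ∈ SU(1,1)` has a well-defined `K`-COMPONENT `kProj g := phase (mat g 0 0) ∈ Circle`, the phase of
the `(0,0)` entry. It is `K`-equivariant on both sides (`kProj_mul_rot`: `kProj (g k) = kProj g · k`,
`kProj_rot_mul`), trivial on the section, on `A` and on `1` (`kProj_sec`, `kProj_hyp`, `kProj_one`),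
`kProj (rot u) = u`, `kProj (n_s) = phase (1 + i s)`, and it carries the cocycle of the fibration:
**`cocycle g z = kProj (g · s(z))`** (`cocycle_eq_kProj`) and hence the multiplication rule
**`kProj (g h) = cocycle g (h·0) · kProj h`** (`kProj_mul`). In Iwasawa coordinates the `K`-part of
`Ψ(ζ, k) = n_s a_t k` is `kProj (n_s a_t) · k` (`kProj_iwasawa`), and the Iwasawa and fibration
coordinates are related by `Ψ(ζ, k) = Φ((n_s a_t)·0, kProj (n_s a_t) · k)` (`iwasawa_eq_fib`).
Nothing is claimed about (N).

Blind lane: Mathlib + the HodgeRepro2 prefix only; no sorry; axioms ⊆ {propext, Classical.choice,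
Quot.sound}.
-/

namespace Summit.Ventures.HodgeRepro2.T5SU11KProjection

open Metric Complex
open T5PoincareDensity T5PoincareInvariance T5SU11Unimodular T5SU11Fibration T5BergmanCoefficient
  T5SU11Cartan T5SU11OneParameter T5SU11UnipotentSubgroup T5SU11IwasawaUnique
  T5SU11FibrationCocycle T5SU11IwasawaMeasure T5SU11BorelHaarNA

/-! ### The `(0,0)` entry under rotations -/

/-- `g₀₀ ≠ 0` for `g ∈ SU(1,1)` (`|g₀₀|² = 1 + |g₀₁|² ≥ 1`). -/
lemma mat_zero_zero_ne_zero (g : SU11) : mat g 0 0 ≠ 0 := by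
  intro h
  have hab : Complex.normSq (mat g 0 0) - Complex.normSq (mat g 0 1) = 1 := normSq_sub_normSq g
  rw [h, map_zero] at hab
  linarith [Complex.normSq_nonneg (mat g 0 1)]

/-- `(g · rot u)₀₀ = g₀₀ · u`. -/
lemma mat_mul_rot_zero_zero (g : SU11) (u : Circle) : mat (g * rot u) 0 0 = mat g 0 0 * u := by
  rw [mat_mul, show mat (rot u) = su11 (u : ℂ) 0 from coe_rot u]
  conv_lhs => rw [show mat g = su11 (mat g 0 0) (mat g 0 1) from coe_eq_su11 g]
  rw [su11_mul]
  simp only [su11, Matrix.of_apply, Matrix.cons_val', Matrix.cons_val_zero, Matrix.empty_val',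
    Matrix.cons_val_fin_one, map_zero, mul_zero, add_zero]

/-- `(rot u · g)₀₀ = u · g₀₀`. -/
lemma mat_rot_mul_zero_zero (u : Circle) (g : SU11) : mat (rot u * g) 0 0 = u * mat g 0 0 := by
  rw [mat_mul, show mat (rot u) = su11 (u : ℂ) 0 from coe_rot u]
  conv_lhs => rw [show mat g = su11 (mat g 0 0) (mat g 0 1) from coe_eq_su11 g]
  rw [su11_mul]
  simp only [su11, Matrix.of_apply, Matrix.cons_val', Matrix.cons_val_zero, Matrix.empty_val',
    Matrix.cons_val_fin_one, zero_mul, add_zero]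

/-! ### The `K`-projection -/

/-- **The `K`-projection**: `kProj g = phase g₀₀`, the rotation in the polar decomposition
`g = s(g·0) · rot (kProj g)`. -/
noncomputable def kProj (g : SU11) : Circle := phase (mat g 0 0)

/-- **The polar decomposition** `g = s(g·0) · rot (kProj g)`. -/
theorem eq_sec_orbit_mul_rot_kProj (g : SU11) : g = sec (orbit g) * rot (kProj g) :=
  eq_sec_orbit_mul_rot g

/-- `kProj` is right-`K`-equivariant: `kProj (g · rot u) = kProj g · u`. -/
theorem kProj_mul_rot (g : SU11) (u : Circle) : kProj (g * rot u) = kProj g * u := by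
  unfold kProj
  rw [mat_mul_rot_zero_zero, phase_mul (mat_zero_zero_ne_zero g) (Circle.coe_ne_zero u), phase_coe]

/-- `kProj` is left-`K`-equivariant: `kProj (rot u · g) = u · kProj g`. -/
theorem kProj_rot_mul (u : Circle) (g : SU11) : kProj (rot u * g) = u * kProj g := by
  unfold kProj
  rw [mat_rot_mul_zero_zero, phase_mul (Circle.coe_ne_zero u) (mat_zero_zero_ne_zero g), phase_coe]

/-- `kProj (rot u) = u`. -/
theorem kProj_rot (u : Circle) : kProj (rot u) = u := by
  unfold kProj
  rw [mat_rot_zero_zero, phase_coe]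

/-- `kProj 1 = 1`. -/
theorem kProj_one : kProj 1 = 1 := by
  unfold kProj
  rw [mat_one, Matrix.one_apply_eq, phase_one]

/-- `kProj (a_t) = 1`: the hyperbolic elements have positive `(0,0)` entry `cosh t`. -/
theorem kProj_hyp (t : ℝ) : kProj (hyp t) = 1 := by
  unfold kProj
  rw [show mat (hyp t) 0 0 = (Real.cosh t : ℂ) from by rw [mat_hyp]; rfl]
  exact phase_ofReal_of_pos (Real.cosh_pos t)

/-- `kProj (s(z)) = 1`: the section has positive `(0,0)` entry `r(z)`. -/
theorem kProj_sec (z : ℂ) : kProj (sec z) = 1 := by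
  unfold kProj
  rw [show mat (sec z) 0 0 = (rad z : ℂ) from by
    rw [show mat (sec z) = su11 (rad z : ℂ) ((rad z : ℂ) * clamp z) from coe_toSU11 _ _ _]; rfl]
  exact phase_ofReal_of_pos (rad_pos z)

/-- `kProj (n_s) = phase (1 + i s)`. -/
theorem kProj_unip (s : ℝ) : kProj (unip s) = phase (1 + (s : ℂ) * I) := by
  unfold kProj
  rw [mat_unip_zero_zero]

/-- `kProj` is a right inverse of `rot`: `kProj ∘ rot = id`, so `kProj` is onto `K`. -/
theorem kProj_surjective : Function.Surjective kProj := fun u => ⟨rot u, kProj_rot u⟩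

/-! ### The cocycle as a `K`-projection and the multiplication rule -/

/-- **`cocycle g z = kProj (g · s(z))`**: the cocycle of the fibration is the `K`-projection of
`g · s(z)`. -/
theorem cocycle_eq_kProj (g : SU11) {z : ℂ} (hz : z ∈ ball (0 : ℂ) 1) :
    cocycle g z = kProj (g * sec z) := by
  rw [mul_sec_eq_sec_mul_rot g hz, kProj_mul_rot, kProj_sec, one_mul]

/-- **The multiplication rule of the `K`-projection**:
`kProj (g h) = cocycle g (h·0) · kProj h`. -/
theorem kProj_mul (g h : SU11) : kProj (g * h) = cocycle g (orbit h) * kProj h := by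
  conv_lhs => rw [eq_sec_orbit_mul_rot_kProj h, ← mul_assoc, kProj_mul_rot]
  rw [cocycle_eq_kProj g (orbit_mem_ball h)]

/-- `kProj (g h) = kProj (g · s(h·0)) · kProj h`. -/
theorem kProj_mul' (g h : SU11) : kProj (g * h) = kProj (g * sec (orbit h)) * kProj h := by
  rw [kProj_mul, cocycle_eq_kProj g (orbit_mem_ball h)]

/-! ### Iwasawa and fibration coordinates -/

/-- **The `K`-part of the Iwasawa decomposition**: `kProj (n_s a_t k) = kProj (n_s a_t) · k`. -/
theorem kProj_iwasawa (ζ : ℂ) (u : Circle) : kProj (iwasawa (ζ, u)) = kProj (borelCoordNA ζ) * u := by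
  rw [iwasawa_apply, kProj_mul_rot]
  rfl

/-- **Iwasawa coordinates in fibration coordinates**:
`Ψ(ζ, k) = n_s a_t k = Φ((n_s a_t)·0, kProj (n_s a_t) · k)`. -/
theorem iwasawa_eq_fib (ζ : ℂ) (u : Circle) :
    iwasawa (ζ, u) = fib (orbit (borelCoordNA ζ), kProj (borelCoordNA ζ) * u) := by
  rw [iwasawa_apply, fib_apply, map_mul, ← mul_assoc]
  show unip ζ.re * hyp ζ.im * rot u =
    sec (orbit (borelCoordNA ζ)) * rot (kProj (borelCoordNA ζ)) * rot u
  rw [← eq_sec_orbit_mul_rot_kProj (borelCoordNA ζ)]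
  rfl

/-- The orbit point of the Iwasawa coordinates: `Ψ(ζ, k)·0 = (n_s a_t)·0`. -/
theorem orbit_iwasawa (ζ : ℂ) (u : Circle) : orbit (iwasawa (ζ, u)) = orbit (borelCoordNA ζ) := by
  rw [iwasawa_eq_fib, orbit_fib (orbit_mem_ball _)]

end Summit.Ventures.HodgeRepro2.T5SU11KProjection
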